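/-
Copyright (c) 2026 the pub-hodgecm-mathlib formalisation cell (harness21).  Prover seat hodgecm-mathlib-F0P3a-p04 (g19): road «S3-ram» ((Cnt2′) chair F0P3a-p07 (g14),
RULING (11): route B, EVEN-ROOT twin of `strataCount_J₀_block`, organ (E2); owner F0P3a-p06 (g15)); 2026-09-02.
-/
import Literature.NumberTheory.Automorphic.UnitaryLatticeTreeRegionGrandchildLabelsOfRootRamified   -- ★ p848574 (F0P2-p02): sandwich tokens `lev_and_lev₂_of_adj_adj_of_lev`, odd-root `regionData_of_root`
import HarnessLib

/-!
# The lattice graph of a hermitian space — LABELS OF THE OFF-REGION GRANDCHILDREN OF A REGION VERTEX, EVEN ROOT DEPTH (tame-ramified place)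
# (Kottwitz 1986 §3; Bruhat–Tits 1972 §10; Serre, *Trees* II.1.1)

Topic `NumberTheory/Automorphic`; namespace `Literature.NumberTheory.Automorphic.UnitaryLatticeTree`.  THEOREMS ONLY (no definition, no instance, no notation, no named fact,
no `sorry`); kernel lane `--supports stmt-HodgeConjecture-24833`.  Cell `pub/hodgecm-mathlib` (D-0151), crux H413; road «S3-ram» (count-neutral); (Cnt2′) route B (chair
F0P3a-p07 (g14) RULINGS (9a′)(11)): the EVEN-root twin of ★ `regionData_of_root` (F0P2-p02, p848574 §4).  With the root depth `d₀ = 2·mA + 2` EVEN, a fixed self-dual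
grandchild `w` of a region vertex `v` OFF the region has, by the ★ §3 sandwich tokens `LEV[w](ϖ^{d₀−2})`, `LEV₂[w](ϖ^{2d₀−2})` and the depth cap: `dep w ∈ {2mA, 2mA+1}`;
at the EVEN depth `2mA` the rank is `2` unless `mA = 0` (★ `engineRowGen_odd`: rank one forces odd depth ≥ 2; at depth `0` the rank label is immaterial); at the ODD depth
`2mA+1` the rank is NOT forced (`LEV₂(ϖ^{2d₀−1})` lies one level beyond the sandwich) — so THREE shell types `E_{mA} ∕ O_{mA} ∕ P^±_{mA}`:
**`regionData_of_root_even`** ⊢ `(dep w = 2mA ∧ (rk w = 2 ∨ dep w = 0)) ∨ (dep w = 2mA+1 ∧ rk w = 2) ∨ (dep w = 2mA+1 ∧ rk w = 1 ∧ (cl w = 1 ∨ cl w = −1))` — the `hlabR`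
disjunction of ★ `strataVec_total_eq_of_localLaw_of_rootRegion_of_labels_even` (this seat, (E1)) at `k v := mA`, CHARACTER FOR CHARACTER.

HONEST LABEL: HC_CM is proved only modulo the 2 remaining named inputs (hLiu418 24832, h413 24833) until rung 0 closes; nothing printed is asserted here (level bookkeeping
over ★ results); «S3-ram» has no books consequence.

## References
* [Kottwitz1986] R. E. Kottwitz, *Base change for unit elements of Hecke algebras*, Compositio Math. 60 (1986), §3 (fixed lattices of a torus element, shells).
* [BruhatTits1972] F. Bruhat, J. Tits, *Groupes réductifs sur un corps local I*, Publ. Math. IHÉS 41 (1972), §10 (lattice models of the building).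
* [Serre1980Trees] J.-P. Serre, *Trees* (1980), Ch. II §1.1 (neighbours, distance two).
-/

set_option autoImplicit false

noncomputable section

open scoped Valued WithZero Matrix MatrixGroups
open Polynomial Classical

namespace Literature.NumberTheory.Automorphic.UnitaryLatticeTree

open Literature.NumberTheory.Automorphic Literature.NumberTheory.Automorphic.HermitianLattice

variable {K : Type*} [Field K] [Valued K ℤᵐ⁰] {σ : K →+* K} {ϖ : K}

/-- **LABELS OF THE OFF-REGION GRANDCHILDREN, EVEN ROOT DEPTH `d₀ = 2·mA + 2`**: `(dep w = 2mA ∧ (rk w = 2 ∨ dep w = 0)) ∨ (dep w = 2mA+1 ∧ rk w = 2) ∨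
(dep w = 2mA+1 ∧ rk w = 1 ∧ cl w = ±1)` (★ §3 sandwich tokens + depth cap + ★ `engineRowGen_odd`). [cite: Kottwitz1986, §3] [cite: BruhatTits1972, §10] [cite: Serre1980Trees, II.1.1] -/
theorem regionData_of_root_even (hσ : ∀ x, σ (σ x) = x) (hvσ : ∀ a, Valued.v (σ a) = Valued.v a) (hσϖ : σ ϖ = -ϖ)
    (hϖ : Valued.v ϖ = WithZero.exp (-1 : ℤ)) (hres : ∀ x : K, Valued.v x ≤ 1 → Valued.v (σ x - x) < 1) (h2 : Valued.v (2 : K) = 1) [Finite 𝓀[K]]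
    {γ : unitaryGroupOfForm σ ((StdForm.antidiagonal 3).over K)}
    {d₀ : ℕ} (c₁ : K)
    (B : ℕ) (dep rk : {M : Submodule 𝒪[K] (Fin 3 → K) // IsVertex σ ϖ ((StdForm.antidiagonal 3).over K) M} → ℕ) (cl : {M : Submodule 𝒪[K] (Fin 3 → K) // IsVertex σ ϖ ((StdForm.antidiagonal 3).over K) M} → ℤ)
    (hdep : ∀ w : {M : Submodule 𝒪[K] (Fin 3 → K) // IsVertex σ ϖ ((StdForm.antidiagonal 3).over K) M}, latticeGraphIso σ ϖ ((StdForm.antidiagonal 3).over K) γ w = w → ∀ e, e ≤ dep w ↔ e ≤ B ∧ w.1.map ((Matrix.toLin' (((γ : GL (Fin 3) K) : Matrix (Fin 3) (Fin 3) K) - 1)).restrictScalars 𝒪[K]) ≤ scaleLattice (ϖ ^ e) w.1)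
    (hrk : ∀ w : {M : Submodule 𝒪[K] (Fin 3 → K) // IsVertex σ ϖ ((StdForm.antidiagonal 3).over K) M}, rk w = if w.1.map ((Matrix.toLin' ((((γ : GL (Fin 3) K) : Matrix (Fin 3) (Fin 3) K) - 1) ^ 2)).restrictScalars 𝒪[K]) ≤ scaleLattice (ϖ ^ (2 * dep w + 1)) w.1 then 1 else 2)
    (hcl : ∀ w : {M : Submodule 𝒪[K] (Fin 3 → K) // IsVertex σ ϖ ((StdForm.antidiagonal 3).over K) M}, cl w = if (∃ y ∈ w.1, ∃ a : K, Valued.v a = 1 ∧ Valued.v ((ϖ ^ (dep w))⁻¹ * pairing σ ((StdForm.antidiagonal 3).over K) y ((((γ : GL (Fin 3) K) : Matrix (Fin 3) (Fin 3) K) - 1) *ᵥ y) - (c₁) * a ^ 2) < 1) then (1 : ℤ) else -1)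
    (hBd : d₀ ≤ B)
    (GC : {M : Submodule 𝒪[K] (Fin 3 → K) // IsVertex σ ϖ ((StdForm.antidiagonal 3).over K) M} → Set {M : Submodule 𝒪[K] (Fin 3 → K) // IsVertex σ ϖ ((StdForm.antidiagonal 3).over K) M}) (hGC : ∀ v w, w ∈ GC v ↔ ∃ c, ((latticeGraph σ ϖ ((StdForm.antidiagonal 3).over K)).Adj v c ∧ (latticeGraph σ ϖ ((StdForm.antidiagonal 3).over K)).dist ⟨stdLattice K 3, 0, isSelfDualLattice_stdLattice_three_of_v hϖ⟩ c = (latticeGraph σ ϖ ((StdForm.antidiagonal 3).over K)).dist ⟨stdLattice K 3, 0, isSelfDualLattice_stdLattice_three_of_v hϖ⟩ v + 1 ∧ c ∈ {v | latticeGraphIso σ ϖ ((StdForm.antidiagonal 3).over K) γ v = v}) ∧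
      ((latticeGraph σ ϖ ((StdForm.antidiagonal 3).over K)).Adj c w ∧ (latticeGraph σ ϖ ((StdForm.antidiagonal 3).over K)).dist ⟨stdLattice K 3, 0, isSelfDualLattice_stdLattice_three_of_v hϖ⟩ w = (latticeGraph σ ϖ ((StdForm.antidiagonal 3).over K)).dist ⟨stdLattice K 3, 0, isSelfDualLattice_stdLattice_three_of_v hϖ⟩ c + 1 ∧ w ∈ {v | latticeGraphIso σ ϖ ((StdForm.antidiagonal 3).over K) γ v = v}))
    (mA : ℕ) (hmA : d₀ = 2 * mA + 2)
    {v : {M : Submodule 𝒪[K] (Fin 3 → K) // IsVertex σ ϖ ((StdForm.antidiagonal 3).over K) M}} (_hfix : latticeGraphIso σ ϖ ((StdForm.antidiagonal 3).over K) γ v = v) (hv : IsSelfDualLattice σ ϖ ((StdForm.antidiagonal 3).over K) v.1) (hvR : v.1.map ((Matrix.toLin' (((γ : GL (Fin 3) K) : Matrix (Fin 3) (Fin 3) K) - 1)).restrictScalars 𝒪[K]) ≤ scaleLattice (ϖ ^ d₀) v.1) :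
    ∀ w ∈ GC v, w ∉ {v : {M : Submodule 𝒪[K] (Fin 3 → K) // IsVertex σ ϖ ((StdForm.antidiagonal 3).over K) M} | latticeGraphIso σ ϖ ((StdForm.antidiagonal 3).over K) γ v = v ∧ IsSelfDualLattice σ ϖ ((StdForm.antidiagonal 3).over K) v.1 ∧ v.1.map ((Matrix.toLin' (((γ : GL (Fin 3) K) : Matrix (Fin 3) (Fin 3) K) - 1)).restrictScalars 𝒪[K]) ≤ scaleLattice (ϖ ^ d₀) v.1} →
      (dep w = 2 * mA ∧ (rk w = 2 ∨ dep w = 0)) ∨ (dep w = 2 * mA + 1 ∧ rk w = 2) ∨ (dep w = 2 * mA + 1 ∧ rk w = 1 ∧ (cl w = 1 ∨ cl w = -1)) := by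
  have hϖ1 : Valued.v ϖ ≤ 1 := by rw [hϖ, ← WithZero.exp_zero]; exact WithZero.exp_le_exp.2 (by norm_num)
  intro w hw hwR'
  obtain ⟨c, ⟨hvc, -, -⟩, hcw, -, hwF⟩ := (hGC _ w).1 hw
  have hfixw : latticeGraphIso σ ϖ ((StdForm.antidiagonal 3).over K) γ w = w := hwF
  -- `w` is self-dual (two steps of the alternation)
  have hc : ¬ IsSelfDualLattice σ ϖ ((StdForm.antidiagonal 3).over K) c.1 := (isSelfDualLattice_iff_not_isSelfDualLattice_of_adj_of_v hvσ hϖ hvc).1 hv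
  have hwS : IsSelfDualLattice σ ϖ ((StdForm.antidiagonal 3).over K) w.1 := by
    by_contra h
    exact hc ((isSelfDualLattice_iff_not_isSelfDualLattice_of_adj_of_v hvσ hϖ hcw).2 h)
  -- off the region = `¬LEV[w](ϖ^{d₀})`
  have hwR : ¬ w.1.map ((Matrix.toLin' (((γ : GL (Fin 3) K) : Matrix (Fin 3) (Fin 3) K) - 1)).restrictScalars 𝒪[K]) ≤ scaleLattice (ϖ ^ d₀) w.1 :=
    fun h => hwR' ⟨hfixw, hwS, h⟩
  -- the sandwich token of ★ §3: `LEV[w](ϖ^{d₀-2})`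
  obtain ⟨hlev, -⟩ := lev_and_lev₂_of_adj_adj_of_lev hvσ hϖ γ hv hwS hvc hcw (by omega) hvR
  -- `2mA ≤ dep w ≤ 2mA + 1`
  have hge : 2 * mA ≤ dep w := (hdep w hfixw (2 * mA)).2 ⟨by omega, by rw [show 2 * mA = d₀ - 2 by omega]; exact hlev⟩
  have hle : dep w ≤ 2 * mA + 1 := by
    by_contra hlt
    have h := ((hdep w hfixw d₀).1 (by omega)).2
    exact hwR h
  have hrk12 : rk w = 1 ∨ rk w = 2 := by
    have h := hrk w
    split_ifs at h
    · exact Or.inl h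
    · exact Or.inr h
  rcases (show dep w = 2 * mA ∨ dep w = 2 * mA + 1 by omega) with hd | hd
  · -- even depth `2mA`: rank two unless depth `0` (rank one forces odd depth ≥ 2, ★ `engineRowGen_odd`)
    refine Or.inl ⟨hd, ?_⟩
    by_cases hm0 : mA = 0
    · exact Or.inr (by rw [hd, hm0])
    · rcases hrk12 with hrk1 | hrk2
      · have hodd := engineRowGen_odd hσ hvσ hσϖ hϖ hres h2 (D := d₀) B dep rk hdep hrk hBd w hwF hwS (by omega) (by omega) hrk1
        rw [hd] at hodd
        exact absurd (⟨mA, by ring⟩ : Even (2 * mA)) (Nat.not_even_iff_odd.2 hodd)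
      · exact Or.inl hrk2
  · -- odd depth `2mA+1`: either rank
    rcases hrk12 with hrk1 | hrk2
    · refine Or.inr (Or.inr ⟨hd, hrk1, ?_⟩)
      rw [hcl w]; split_ifs <;> simp
    · exact Or.inr (Or.inl ⟨hd, hrk2⟩)

end Literature.NumberTheory.Automorphic.UnitaryLatticeTree

end
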